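import Mathlib
import Literature.Analysis.Asymptotics.LogarithmicSummabilityTauberian
import HarnessLib

/-!
# Móricz 2013, Corollary 3 (= Kwee 1967, Lemma 3) — proof

Discharge of the named fact `Literature.Analysis.Asymptotics.Moricz2013_corollary3`
(`LogarithmicSummabilityTauberian.lean`): a real sequence that is slowly decreasing with respect
to logarithmic summability `(L, 1)` and summable `(L, 1)` to `A` converges to `A`.

We follow the printed proof (F. Móricz, Studia Math. 219 (2013), arXiv:1206.6188, §5: Theorem 4
via Lemma 2, of which Corollary 3 is "an immediate consequence").  With `ℓ_n = Σ_{k≤n} 1/k`,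
`S_n = Σ_{k≤n} s_k/k`, `τ_n = S_n/ℓ_n` and `m = ⌊n^λ⌋`, Lemma 2 (i) is the identity
`Σ_{n<k≤m} (s_k - s_n)/k = (S_m - S_n) - s_n (ℓ_m - ℓ_n)`, i.e.
`s_n (ℓ_m - ℓ_n) = (τ_m - τ_n) ℓ_m + τ_n (ℓ_m - ℓ_n) - Σ_{n<k≤m} (s_k - s_n)/k`; slow decrease
bounds the last sum below by `-ε (ℓ_m - ℓ_n)`, and `ℓ_m/(ℓ_m - ℓ_n)` stays bounded because
`ℓ_n ≤ 1 + log n` and `ℓ_m ≥ log (m+1) ≥ λ log n` (Mathlib's `harmonic_le_one_add_log`,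
`log_add_one_le_harmonic`), so `limsup (s_n - τ_n) ≤ ε`; Lemma 2 (ii) with `m' = ⌊n^{1/λ}⌋`
gives `liminf (s_n - τ_n) ≥ -ε` in the same way.  The proof below is the `ε`–`N` rendering of
this argument (no `limsup`/`liminf` bookkeeping).

## References
* [Moricz2013] F. Móricz, *Necessary and sufficient Tauberian conditions for the logarithmic
  summability of functions and sequences*, Studia Math. 219 (2013) 109–121, arXiv:1206.6188,
  §5 Theorem 4, Lemma 2, Corollary 3.
-/

namespace Literature.Analysis.Asymptotics

open _root_.Filter _root_.Finset
open scoped _root_.Topology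

section Moricz2013Proof

/-- `Σ_{k ∈ [1, n]} f k = Σ_{k ∈ (0, n]} f k` over `ℕ`. [folklore] -/
private theorem Moricz2013.sum_Icc_eq_sum_Ioc (f : ℕ → ℝ) (n : ℕ) :
    ∑ k ∈ Icc 1 n, f k = ∑ k ∈ Ioc 0 n, f k :=
  Finset.sum_congr (by ext k; simp only [Finset.mem_Icc, Finset.mem_Ioc]; omega) fun _ _ => rfl

/-- Tail sums: `Σ_{k≤m} f - Σ_{k≤n} f = Σ_{n<k≤m} f` for `n ≤ m`. [folklore] -/
private theorem Moricz2013.sum_Icc_sub_sum_Icc (f : ℕ → ℝ) {n m : ℕ} (hnm : n ≤ m) :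
    ∑ k ∈ Icc 1 m, f k - ∑ k ∈ Icc 1 n, f k = ∑ k ∈ Ioc n m, f k := by
  rw [Moricz2013.sum_Icc_eq_sum_Ioc, Moricz2013.sum_Icc_eq_sum_Ioc,
    ← Finset.sum_Ioc_consecutive f (Nat.zero_le n) hnm]
  ring

/-- `ℓ_n = Σ_{k=1}^n 1/k` is Mathlib's harmonic number. [folklore] -/
private theorem Moricz2013.sum_one_div_eq_harmonic (n : ℕ) :
    ∑ k ∈ Icc 1 n, (1 : ℝ) / k = (harmonic n : ℝ) := by
  rw [harmonic_eq_sum_Icc]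
  push_cast
  exact Finset.sum_congr rfl fun k _ => one_div _

/-- `log (n + 1) ≤ ℓ_n`. [folklore] -/
private theorem Moricz2013.log_le_ell (n : ℕ) :
    Real.log ((n : ℝ) + 1) ≤ ∑ k ∈ Icc 1 n, (1 : ℝ) / k := by
  have h := log_add_one_le_harmonic n
  rw [Moricz2013.sum_one_div_eq_harmonic]
  push_cast at h
  exact h

/-- `ℓ_n ≤ 1 + log n`. [folklore] -/
private theorem Moricz2013.ell_le_log (n : ℕ) :
    ∑ k ∈ Icc 1 n, (1 : ℝ) / k ≤ 1 + Real.log n := by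
  rw [Moricz2013.sum_one_div_eq_harmonic]
  exact harmonic_le_one_add_log n

/-- `0 < ℓ_n` for `n ≥ 1`. [folklore] -/
private theorem Moricz2013.ell_pos {n : ℕ} (hn : 1 ≤ n) : 0 < ∑ k ∈ Icc 1 n, (1 : ℝ) / k := by
  refine Finset.sum_pos (fun k hk => ?_) ⟨1, Finset.mem_Icc.2 ⟨le_rfl, hn⟩⟩
  have : 1 ≤ k := (Finset.mem_Icc.1 hk).1
  positivity

/-- **Lemma 2 of Móricz 2013 in cleared form**: for `n ≤ m`,
`Σ_{n<k≤m} (s_k - c)/k = (S_m - S_n) - c (ℓ_m - ℓ_n)`. [cite: Moricz2013, Lemma 2] -/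
private theorem Moricz2013.sum_sub_div (s : ℕ → ℝ) (c : ℝ) {n m : ℕ} (hnm : n ≤ m) :
    ∑ k ∈ Ioc n m, (s k - c) / k
      = (∑ k ∈ Icc 1 m, s k / k - ∑ k ∈ Icc 1 n, s k / k)
        - c * (∑ k ∈ Icc 1 m, (1 : ℝ) / k - ∑ k ∈ Icc 1 n, (1 : ℝ) / k) := by
  rw [Moricz2013.sum_Icc_sub_sum_Icc _ hnm, Moricz2013.sum_Icc_sub_sum_Icc _ hnm,
    Finset.mul_sum, ← Finset.sum_sub_distrib]
  refine Finset.sum_congr rfl fun k _ => ?_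
  rw [sub_div, mul_one_div]

/-- Slow decrease summed: if `-ε ≤ s_k - c` for `n < k ≤ m`, then
`-ε (ℓ_m - ℓ_n) ≤ Σ_{n<k≤m} (s_k - c)/k`. [folklore] -/
private theorem Moricz2013.sum_sub_div_ge (s : ℕ → ℝ) (c ε : ℝ) {n m : ℕ} (hnm : n ≤ m)
    (h : ∀ k, n < k → k ≤ m → -ε ≤ s k - c) :
    -ε * (∑ k ∈ Icc 1 m, (1 : ℝ) / k - ∑ k ∈ Icc 1 n, (1 : ℝ) / k)
      ≤ ∑ k ∈ Ioc n m, (s k - c) / k := by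
  rw [Moricz2013.sum_Icc_sub_sum_Icc _ hnm, Finset.mul_sum]
  refine Finset.sum_le_sum fun k hk => ?_
  obtain ⟨hnk, hkm⟩ := Finset.mem_Ioc.1 hk
  rw [mul_one_div]
  exact div_le_div_of_nonneg_right (h k hnk hkm) (by positivity)

/-- Lemma 2 (ii) in cleared form: for `m ≤ n`,
`Σ_{m<k≤n} (c - s_k)/k = c (ℓ_n - ℓ_m) - (S_n - S_m)`. [cite: Moricz2013, Lemma 2] -/
private theorem Moricz2013.sum_sub_div' (s : ℕ → ℝ) (c : ℝ) {m n : ℕ} (hmn : m ≤ n) :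
    ∑ k ∈ Ioc m n, (c - s k) / k
      = c * (∑ k ∈ Icc 1 n, (1 : ℝ) / k - ∑ k ∈ Icc 1 m, (1 : ℝ) / k)
        - (∑ k ∈ Icc 1 n, s k / k - ∑ k ∈ Icc 1 m, s k / k) := by
  rw [Moricz2013.sum_Icc_sub_sum_Icc _ hmn, Moricz2013.sum_Icc_sub_sum_Icc _ hmn,
    Finset.mul_sum, ← Finset.sum_sub_distrib]
  refine Finset.sum_congr rfl fun k _ => ?_
  rw [sub_div, mul_one_div]

/-- Slow decrease summed, second form: if `-ε ≤ c - s_k` for `m < k ≤ n`, then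
`-ε (ℓ_n - ℓ_m) ≤ Σ_{m<k≤n} (c - s_k)/k`. [folklore] -/
private theorem Moricz2013.sum_sub_div_ge' (s : ℕ → ℝ) (c ε : ℝ) {m n : ℕ} (hmn : m ≤ n)
    (h : ∀ k, m < k → k ≤ n → -ε ≤ c - s k) :
    -ε * (∑ k ∈ Icc 1 n, (1 : ℝ) / k - ∑ k ∈ Icc 1 m, (1 : ℝ) / k)
      ≤ ∑ k ∈ Ioc m n, (c - s k) / k := by
  rw [Moricz2013.sum_Icc_sub_sum_Icc _ hmn, Finset.mul_sum]
  refine Finset.sum_le_sum fun k hk => ?_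
  obtain ⟨hmk, hkn⟩ := Finset.mem_Ioc.1 hk
  rw [mul_one_div]
  exact div_le_div_of_nonneg_right (h k hmk hkn) (by positivity)

/-- **Móricz 2013, Corollary 3 (= Kwee 1967, Lemma 3) — proved** (discharge of
`Moricz2013_corollary3`): slow decrease with respect to `(L, 1)` plus `(L, 1)`-summability to `A`
imply convergence to `A`.  Printed proof: Theorem 4 via Lemma 2 of the source.
[cite: Moricz2013, Cor. 3 with (5.1), (5.6); §5 Theorem 4 and Lemma 2] -/
theorem Moricz2013_corollary3_holds : Moricz2013_corollary3 := by
  intro s A hsd hτ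
  classical
  -- names: `L n = ℓ_n`, `S n = Σ_{k≤n} s_k/k`, `τ n = S n / L n`
  obtain ⟨L, hL⟩ : ∃ L : ℕ → ℝ, ∀ n, L n = ∑ k ∈ Icc 1 n, (1 : ℝ) / k := ⟨_, fun _ => rfl⟩
  obtain ⟨S, hS⟩ : ∃ S : ℕ → ℝ, ∀ n, S n = ∑ k ∈ Icc 1 n, s k / k := ⟨_, fun _ => rfl⟩
  obtain ⟨τ, hτdef⟩ : ∃ τ : ℕ → ℝ, ∀ n, τ n = S n / L n := ⟨_, fun _ => rfl⟩
  have hτ' : Tendsto τ atTop (𝓝 A) := by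
    have e : τ = fun n : ℕ => (∑ k ∈ Icc 1 n, s k / k) / ∑ k ∈ Icc 1 n, (1 : ℝ) / k :=
      funext fun n => by rw [hτdef, hS, hL]
    rw [e]
    exact hτ
  -- basic facts about `L`
  have hLpos : ∀ n, 1 ≤ n → 0 < L n := fun n hn => by rw [hL]; exact Moricz2013.ell_pos hn
  have hLlow : ∀ n : ℕ, Real.log ((n : ℝ) + 1) ≤ L n := fun n => by
    rw [hL]; exact Moricz2013.log_le_ell n
  have hLup : ∀ n : ℕ, L n ≤ 1 + Real.log n := fun n => by rw [hL]; exact Moricz2013.ell_le_log n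
  have hSL : ∀ n, 1 ≤ n → S n = τ n * L n := fun n hn => by
    rw [hτdef, div_mul_cancel₀ _ (hLpos n hn).ne']
  -- ε–N
  rw [Metric.tendsto_atTop]
  intro ε hε
  set ε' : ℝ := ε / 4 with hε'
  have hε'pos : 0 < ε' := by positivity
  obtain ⟨n₀, l, hl, hslow⟩ := hsd ε' hε'pos
  -- the constant bounding `ℓ_m / (ℓ_m - ℓ_n)`
  set θ : ℝ := (1 + 1 / l) / 2 with hθ
  have hl0 : 0 < l := by linarith
  have hθlt : θ < 1 := by
    have : 1 / l < 1 := (div_lt_one hl0).2 hl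
    rw [hθ]; linarith
  have hθgt : 1 / l < θ := by
    have : 1 / l < 1 := (div_lt_one hl0).2 hl
    rw [hθ]; linarith
  have hθpos : 0 < θ := lt_trans (by positivity) hθgt
  set K : ℝ := 1 / (1 - θ) with hK
  have hKpos : 0 < K := by rw [hK]; exact div_pos one_pos (by linarith)
  have hK1 : K * (1 - θ) = 1 := by rw [hK, div_mul_cancel₀ _ (by linarith)]
  -- `τ` is eventually within `δ` of `A`
  set δ : ℝ := ε' / (2 * K + 1) with hδ
  have hδpos : 0 < δ := by positivity
  have hδK : δ * (2 * K + 1) = ε' := by rw [hδ, div_mul_cancel₀ _ (by positivity)]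
  obtain ⟨Nτ, hNτ⟩ := (Metric.tendsto_atTop.1 hτ') δ hδpos
  -- the threshold
  set c : ℕ := Nτ + n₀ + 2 with hc
  refine ⟨n₀ + Nτ + ⌈Real.exp (2 * l / (l - 1))⌉₊ + ⌈((c : ℝ)) ^ l⌉₊ + 2, fun n hn => ?_⟩
  have hn0 : n₀ ≤ n := by omega
  have hnτ : Nτ ≤ n := by omega
  have hn2 : 2 ≤ n := by omega
  have hn1 : 1 ≤ n := by omega
  have hnR : (1 : ℝ) ≤ n := by exact_mod_cast hn1
  have hnpos : (0 : ℝ) < n := by positivity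
  have hlogn_pos : 0 < Real.log n := Real.log_pos (by exact_mod_cast hn2)
  -- `log n ≥ 2 l / (l - 1)`
  have hlogn : 2 * l / (l - 1) ≤ Real.log n := by
    rw [Real.le_log_iff_exp_le hnpos]
    have h1 : (⌈Real.exp (2 * l / (l - 1))⌉₊ : ℝ) ≤ n := by exact_mod_cast (by omega : ⌈Real.exp (2 * l / (l - 1))⌉₊ ≤ n)
    exact (Nat.le_ceil _).trans h1
  -- consequences: `1 + log n ≤ θ l log n` and `1 + (1/l) log n ≤ θ log n`
  have hlm1 : 0 < l - 1 := by linarith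
  have hlne : l ≠ 0 := hl0.ne'
  have h2l : 2 * l ≤ Real.log n * (l - 1) := (div_le_iff₀ hlm1).1 hlogn
  have hkey1 : 1 + Real.log n ≤ θ * l * Real.log n := by
    have e : θ * l = 1 + (l - 1) / 2 := by rw [hθ]; field_simp; ring
    rw [e]
    linarith
  have hkey2 : 1 + (1 / l) * Real.log n ≤ θ * Real.log n := by
    have h3 : 2 ≤ (1 - 1 / l) * Real.log n := by
      rw [show (1 - 1 / l) * Real.log n = (Real.log n * (l - 1)) / l by field_simp,
        le_div_iff₀ hl0]
      linarith
    rw [hθ]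
    linarith
  -- `|τ k - A| < δ` for `k ≥ Nτ`
  have hτA : ∀ k, Nτ ≤ k → |τ k - A| < δ := fun k hk => by
    have := hNτ k hk; rwa [Real.dist_eq] at this
  ------------------------------------------------------------------
  -- UPPER BOUND via `m = ⌊n^l⌋`
  ------------------------------------------------------------------
  have hup : s n < A + 2 * ε' := by
    set m : ℕ := ⌊(n : ℝ) ^ l⌋₊ with hm
    have hnl_pos : 0 < (n : ℝ) ^ l := Real.rpow_pos_of_pos hnpos l
    have hn_le_nl : (n : ℝ) ≤ (n : ℝ) ^ l := by
      have := Real.rpow_le_rpow_of_exponent_le hnR hl.le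
      rwa [Real.rpow_one] at this
    have hnm : n ≤ m := Nat.le_floor hn_le_nl
    have hm_le : (m : ℝ) ≤ (n : ℝ) ^ l := Nat.floor_le hnl_pos.le
    have hm_lt : (n : ℝ) ^ l < (m : ℝ) + 1 := Nat.lt_floor_add_one _
    have hm1 : 1 ≤ m := hn1.trans hnm
    -- `L m ≥ l log n`
    have hLm : l * Real.log n ≤ L m := by
      have h1 : Real.log ((n : ℝ) ^ l) ≤ Real.log ((m : ℝ) + 1) :=
        Real.log_le_log hnl_pos hm_lt.le
      rw [Real.log_rpow hnpos] at h1
      exact h1.trans (hLlow m)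
    -- `L n ≤ θ L m`, so `D := L m - L n ≥ (1 - θ) L m > 0` and `L m ≤ K D`
    have hLm_pos : 0 < L m := hLpos m hm1
    have hLn : L n ≤ θ * L m :=
      calc L n ≤ 1 + Real.log n := hLup n
        _ ≤ θ * l * Real.log n := hkey1
        _ = θ * (l * Real.log n) := by ring
        _ ≤ θ * L m := mul_le_mul_of_nonneg_left hLm hθpos.le
    have hθL : 0 < (1 - θ) * L m := mul_pos (by linarith) hLm_pos
    have hD : 0 < L m - L n := by linarith
    have hLmD : L m ≤ K * (L m - L n) := by
      have h := mul_le_mul_of_nonneg_left (show (1 - θ) * L m ≤ L m - L n by linarith) hKpos.le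
      rwa [← mul_assoc, hK1, one_mul] at h
    -- slow decrease on `(n, m]`
    have hsd' : ∀ k, n < k → k ≤ m → -ε' ≤ s k - s n := by
      intro k hnk hkm
      refine hslow n k hn0 hnk ?_
      exact (show (k : ℝ) ≤ m by exact_mod_cast hkm).trans hm_le
    have h1 := Moricz2013.sum_sub_div_ge s (s n) ε' hnm hsd'
    rw [Moricz2013.sum_sub_div s (s n) hnm, ← hS, ← hS, ← hL, ← hL, hSL m hm1, hSL n hn1] at h1
    -- `h1 : -ε' (L m - L n) ≤ (τ m L m - τ n L n) - s n (L m - L n)`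
    have hτmn : |τ m - τ n| < 2 * δ := by
      have e : τ m - τ n = (τ m - A) - (τ n - A) := by ring
      rw [e]
      refine (abs_sub _ _).trans_lt ?_
      linarith [hτA m (hnτ.trans hnm), hτA n hnτ]
    have hτn : τ n < A + δ := by linarith [(abs_lt.1 (hτA n hnτ)).2]
    have hA1 : (τ m - τ n) * L m ≤ |τ m - τ n| * (K * (L m - L n)) :=
      (mul_le_mul_of_nonneg_right (le_abs_self _) hLm_pos.le).trans
        (mul_le_mul_of_nonneg_left hLmD (abs_nonneg _))
    have h2 : s n * (L m - L n) ≤ (|τ m - τ n| * K + τ n + ε') * (L m - L n) := by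
      linarith [h1, hA1]
    have h4 : s n ≤ |τ m - τ n| * K + τ n + ε' := le_of_mul_le_mul_right h2 hD
    have h5 : |τ m - τ n| * K < 2 * δ * K := mul_lt_mul_of_pos_right hτmn hKpos
    linarith [h4, h5, hτn, hδK]
  ------------------------------------------------------------------
  -- LOWER BOUND via `m' = ⌊n^(1/l)⌋`
  ------------------------------------------------------------------
  have hlow : A - 2 * ε' < s n := by
    set m : ℕ := ⌊(n : ℝ) ^ (1 / l)⌋₊ with hm
    have hnl_pos : 0 < (n : ℝ) ^ (1 / l) := Real.rpow_pos_of_pos hnpos _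
    have hm_le : (m : ℝ) ≤ (n : ℝ) ^ (1 / l) := Nat.floor_le hnl_pos.le
    have hm_lt : (n : ℝ) ^ (1 / l) < (m : ℝ) + 1 := Nat.lt_floor_add_one _
    -- `n^(1/l) ≤ n`, so `m ≤ n`
    have hnl_le_n : (n : ℝ) ^ (1 / l) ≤ n := by
      have := Real.rpow_le_rpow_of_exponent_le hnR ((div_le_one hl0).2 hl.le)
      rwa [Real.rpow_one] at this
    have hmn : m ≤ n := by
      have : (m : ℝ) ≤ n := hm_le.trans hnl_le_n
      exact_mod_cast this
    -- `c ≤ n^(1/l)`, so `m ≥ c = Nτ + n₀ + 2`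
    have hcm : c ≤ m := by
      refine Nat.le_floor ?_
      have h1 : ((c : ℝ)) ^ l ≤ n := by
        have : (⌈((c : ℝ)) ^ l⌉₊ : ℝ) ≤ n := by exact_mod_cast (by omega : ⌈((c : ℝ)) ^ l⌉₊ ≤ n)
        exact (Nat.le_ceil _).trans this
      have h2 := Real.rpow_le_rpow (by positivity) h1 (by positivity : (0 : ℝ) ≤ 1 / l)
      rw [one_div, Real.rpow_rpow_inv (by positivity) hl0.ne'] at h2
      rwa [one_div]
    have hm1 : 1 ≤ m := by omega
    have hmτ : Nτ ≤ m := by omega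
    have hmpos : (0 : ℝ) < m := by exact_mod_cast hm1
    -- `L m ≤ θ L n`, so `D' := L n - L m ≥ (1 - θ) L n > 0` and `L m ≤ K D'`
    have hLn_pos : 0 < L n := hLpos n hn1
    have hLm_pos : 0 < L m := hLpos m hm1
    have hLm : L m ≤ θ * L n := by
      have h1 : Real.log m ≤ (1 / l) * Real.log n := by
        have := Real.log_le_log hmpos hm_le
        rwa [Real.log_rpow hnpos] at this
      have h2 : Real.log n ≤ L n := (Real.log_le_log hnpos (by linarith)).trans (hLlow n)
      calc L m ≤ 1 + Real.log m := hLup m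
        _ ≤ 1 + (1 / l) * Real.log n := by linarith
        _ ≤ θ * Real.log n := hkey2
        _ ≤ θ * L n := mul_le_mul_of_nonneg_left h2 hθpos.le
    have hθL : 0 < (1 - θ) * L n := mul_pos (by linarith) hLn_pos
    have hθL' : θ * L n ≤ L n := mul_le_of_le_one_left hLn_pos.le hθlt.le
    have hD : 0 < L n - L m := by linarith
    have hLmD : L m ≤ K * (L n - L m) := by
      have h := mul_le_mul_of_nonneg_left (show (1 - θ) * L n ≤ L n - L m by linarith) hKpos.le
      rw [← mul_assoc, hK1, one_mul] at h
      linarith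
    -- slow decrease on `(m, n]` (with the roles of `n` and `k` exchanged)
    have hsd' : ∀ k, m < k → k ≤ n → -ε' ≤ s n - s k := by
      intro k hmk hkn
      rcases Nat.lt_or_eq_of_le hkn with hkn' | rfl
      · refine hslow k n (by omega) hkn' ?_
        -- `n ≤ k^l` since `k > n^(1/l)`
        have hk : (n : ℝ) ^ (1 / l) < k := by
          have : (m : ℝ) + 1 ≤ k := by exact_mod_cast hmk
          exact hm_lt.trans_le this
        have h2 := Real.rpow_le_rpow hnl_pos.le hk.le hl0.le
        rwa [one_div, Real.rpow_inv_rpow hnpos.le hl0.ne'] at h2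
      · simp [hε'pos.le]
    have h1 := Moricz2013.sum_sub_div_ge' s (s n) ε' hmn hsd'
    rw [Moricz2013.sum_sub_div' s (s n) hmn, ← hS, ← hS, ← hL, ← hL, hSL n hn1, hSL m hm1] at h1
    -- `h1 : -ε' (L n - L m) ≤ s n (L n - L m) - (τ n L n - τ m L m)`
    have hτnm : |τ n - τ m| < 2 * δ := by
      have e : τ n - τ m = (τ n - A) - (τ m - A) := by ring
      rw [e]
      refine (abs_sub _ _).trans_lt ?_
      linarith [hτA m hmτ, hτA n hnτ]
    have hτn : A - δ < τ n := by linarith [(abs_lt.1 (hτA n hnτ)).1]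
    have hA1 : -(|τ n - τ m| * (K * (L n - L m))) ≤ (τ n - τ m) * L m := by
      have h1' : -(|τ n - τ m| * L m) ≤ (τ n - τ m) * L m := by
        rw [← neg_mul]
        exact mul_le_mul_of_nonneg_right (neg_abs_le _) hLm_pos.le
      have h2' : |τ n - τ m| * L m ≤ |τ n - τ m| * (K * (L n - L m)) :=
        mul_le_mul_of_nonneg_left hLmD (abs_nonneg _)
      linarith
    have h2 : (τ n - ε' - |τ n - τ m| * K) * (L n - L m) ≤ s n * (L n - L m) := by
      linarith [h1, hA1]
    have h4 : τ n - ε' - |τ n - τ m| * K ≤ s n := le_of_mul_le_mul_right h2 hD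
    have h5 : |τ n - τ m| * K < 2 * δ * K := mul_lt_mul_of_pos_right hτnm hKpos
    linarith [h4, h5, hτn, hδK]
  -- conclusion
  rw [Real.dist_eq, abs_lt]
  constructor <;> linarith

end Moricz2013Proof

end Literature.Analysis.Asymptotics
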